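import Summits.QuantumFields.BalabanUV.T4Continuum.Spine.NE1p.DressedTowerWitnessRegen
import Summits.QuantumFields.BalabanUV.T4Continuum.Spine.NE1p.DressedRootFam

/-!
# T⁴ programme, spine estimate NE1′ (node O3b/H2) — LIVE REGENERATION (w5) AT EVERY CUTOFF, part 2: the assembled slice-window END
# BY NAME on the regenerating datum, the bundle over the cell `UR` (`c̄ > 0`), END-B's CLOSED LOOP, the root, the With-form, ROOT-B
# (formalisation crew `b2b-balaban-t4-ne1p-formalise-*`, leaf seat 03, generation 3, witness item W10; own-initiative consistency
# item, NOT a crew estimate row)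

Cell `pub-balaban`, sub-cell `t4`, BINDER-OWNERS row NE1′ (owner lineage t4-ne1p-p1).  ADDITIVE — imports part 1
`Spine/NE1p/DressedTowerWitnessRegen` (the cell `UR` with `c̄_R = (8·LW)⁻¹`, the regenerating booking ∕ trajectory ∕ tower `BR` ∕ `TR` ∕
`towerR`, the carried functionals `FnR` of every generation, the binders `hslR` ∕ `FnR_succ` ∕ `hlinR` ∕ `hbirthR` ∕ `hregR` ∕ `hcountR` ∕
`hSgR` ∕ `hδfR` ∕ `hdomR` ∕ `positionalCount_towerR`; through it rows W7 ∕ W5, leaf-04's `DressedTransportAssembledModSliceWin`, row S3's cell)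
and the owner's `Spine/NE1p/DressedRootFam` (p211697: ROOT-B `DressedBudget`, `dressedBudget_of_dressedStabilityWith_strict`) ONLY;
modifies nothing.  One namespace with part 1.

CONTENTS.
* §1 **`htrR K`** — leaf-04's `transportLeaf_assembled_mod_swin_of_schedule Wm …` BY NAME on the regenerating datum at EVERY cutoff:
  `hFn := FnR_succ` and `hlin := hlinR` for EVERY generation `k′` (not only the birth generation), births `hslR` for every `k′`, the
  (I4′) ∕ pair ∕ (w4) lemmas of row W7 on this booking, `Asz := aszRec gen 0 0`, `𝒜 ≡ 0`, `c := 0`, `s ≡ 0` (declared).  Conclusion: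
  the transport leaf `htr` at `C = 2`, rate `ψ·alphaCell ½`, gated by the dressed budget with `m = ⅛`.
* §2 **`leavesR K : BookingLeaves UR (BR K) (TR K)`** — row S3's `bookingLeavesCell` over the cell **with `c̄ = c̄_R > 0`**: regeneration
  constants **`c := fun _ => c̄_R`** (`hc0`, and `hcb : c̄_R ≤ c̄_R` — EQUALITY), **`hreg := hregR K _` (EQUALITY at every step)**,
  `hbirth := hbirthR K _` (equality at birth), `htr := htrR K`; so the cell's compatibility `hrate : ρ k + C·c k ≤ ρ₁` reads
  `ψ·alphaCell ½ + 2·c̄_R ≤ 3∕(4LW)` with BOTH terms live.  `classAt_towerR` — END-B's per-cutoff face.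
* §3 **`dressedStability_towerR : DressedStability towerR`** — END-B `dressedStability_of_cell` with the ONE `UR` at EVERY cutoff: the
  class is CLOSED BY END-B's LOOP (`dressedBudget_closed` ∘ `sizeBoundAt_of_envBoundAtVar`: live transport × LIVE REGENERATION ×
  convention (A), `T4TrajectoryComparison`) — the first time that loop runs with `gen b (k+1) > 0`; the With-form
  `dressedStabilityWith_towerR : DressedStabilityWith towerR 1 (rhoOne ψ 2 c̄_R ½) LW⁻³` (family factor `3∕(4LW) < 1`, part 1
  `rhoOne_R_lt_one`); ROOT-B `dressedBudget_towerR` for every bounded run-weight family (`DressedRootFam`'s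
  `dressedBudget_of_dressedStabilityWith_strict`, strict product `LW⁴·ρ₁·LW⁻³ = ¾ < 1` by `prod_cell` ∘ `locCell_R`) and the closed
  unit-weight instance; `sizeBound_towerR` (END's consumer face: every booked size — birth AND regenerated generations summed — below
  the two-rate profile, at every cutoff).

HONEST FRAMING.  A decided toy: [folklore] kernel glue, 0 sorry, 0 citations, no `def … : Prop` (the one `def` is a
`BookingLeaves`-valued TERM); `𝒜 ≡ 0`, `c := 0`, `s ≡ 0`, `rel = Eq`, two-atom laws, one family — toy labelled toy; NOTHING of
Bałaban's (w5) constant, of [Balaban1989LargeFieldII] (1.89), or of the real densities is asserted (CONTEXT only).  Headline (c4):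
«the (w5) family `hreg`∕`hc0`∕`hcb` with `c̄ > 0` — and with it the `C·c̄` ∕ `L·C·c̄` terms of `rhoOne` ∕ `locCell` and END-B's full loop —
are inhabitable NON-TRIVIALLY at every cutoff, jointly with every other family of END-F′ ∕ END-B, ONE K-free `U`, ONE cutoff-free
schedule; non-vacuity of SHAPES; NE1′ ⇐ the named binders, NOT proved»; spine PROVED 0∕9.  Rung (B)+1 on ONE finite four-torus — NOT
infinite volume, NOT a mass gap, NOT OS on ℝ⁴, NOT Clay, NOT summit progress.  HONEST DEPENDENCY: continuum YM on T⁴ ⇐ BetaPertH ∧ nine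
spine estimates (0/9 proved); BetaPertH ⇐ (D1) ∧ (D4) ∧ CAP+tail; G-an2-4 gates asym, D1 and NE2/3/4.
-/

noncomputable section

namespace Summit.QuantumFields.BalabanUV.T4Continuum.NE1p.DressedTowerWitnessRegen

open MeasureTheory Set Metric Filter Finset
open scoped BigOperators
open Literature.MathematicalPhysics.QuantumFieldTheory.Balaban1983to89
open Literature.MathematicalPhysics.QuantumFieldTheory.Balaban1983to89.T4TermFormat
open Literature.MathematicalPhysics.QuantumFieldTheory.Balaban1983to89.T4TermFormat.Booking
open Literature.MathematicalPhysics.QuantumFieldTheory.Balaban1983to89.T4GatedBooking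
open Literature.MathematicalPhysics.QuantumFieldTheory.Balaban1983to89.T4TrajectoryComparison
open T4TrajectoryModulus (bondBall bondBall_add_mem bondBall_latMove_add_mem bondBall_diam)
open T4BlockTransport (Fld NDir latMove latN Site norm_dir_le)
open T4BirthChartTransport (GaugeInvariant BirthSlice RelGauge)
open T4TrajectoryDensity
open Summit.QuantumFields.BalabanUV.T4Continuum.T4TrajectoryDensityDressed
open Summit.QuantumFields.BalabanUV.T4Continuum.T4TrajectoryDensityWitness
open Summit.QuantumFields.BalabanUV.T4Continuum.NE1p.DressedRoot
open Summit.QuantumFields.BalabanUV.T4Continuum.NE1p.DressedUniformConstants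
open Summit.QuantumFields.BalabanUV.T4Continuum.NE1p.DressedWindowScheduleWin
open Summit.QuantumFields.BalabanUV.T4Continuum.NE1p.DressedWindowScheduleModWin
open Summit.QuantumFields.BalabanUV.T4Continuum.NE1p.DressedTowerWitness
open Summit.QuantumFields.BalabanUV.T4Continuum.NE1p.DressedTowerWitnessSlice
open Summit.QuantumFields.BalabanUV.T4Continuum.NE1p.DressedTransportAssembledModData
open Summit.QuantumFields.BalabanUV.T4Continuum.NE1p.DressedTransportAssembledModSliceWin

/-! ## §1 The assembled slice-window END BY NAME on the regenerating datum [folklore] -/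

/-- **END-F′-mod-swin ON THE REGENERATING DATUM, AT EVERY CUTOFF** — leaf-04's `transportLeaf_assembled_mod_swin_of_schedule Wm …` BY
NAME, with `hFn := FnR_succ`, `hsl := hslR`, `hlin := hlinR` for EVERY generation `k′ ≤ k` (a live generation at every scale), row W7's
(I4′) ∕ fresh-pair ∕ (w4) lemmas, `Asz := aszRec gen 0 0`; `𝒜 ≡ 0`, `c := 0`, `s ≡ 0` declared.  Conclusion: the transport leaf `htr`
at `C = 4·½∕1`, rate `ψ·alphaCell ½`, gated by the dressed budget with `m = ⅛`. [folklore] -/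
theorem htrR (K : ℕ) :
    (TR K).TransportsFromVar (4 * (1 / 2) / 1) (fun i => (LW ^ 2)⁻¹ * (fun _ : ℕ => alphaCell (1 / 2)) i)
      (budgetGate (TR K) (fun _ _ => 0) (1 / 8) (fun _ b => {b}) (4 * (1 / 2) / 1)
        (fun i => (LW ^ 2)⁻¹ * (fun _ : ℕ => alphaCell (1 / 2)) i)) :=
  transportLeaf_assembled_mod_swin_of_schedule Wm (T := TR K) (Fn := fun _ k' k => FnR K k' k)
    (rel := fun _ _ _ U U' => U = U') (ref := fun _ _ U => U) (base := fun _ _ => base₁) (𝒜 := fun _ _ => zeroExp)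
    (𝒬 := fun _ _ => zeroExp) (q := fun _ _ _ => 0) (μ := fun _ k => flAt (atomW (k + 1))) (z₀ := fun _ _ => 0)
    (z₁ := fun _ _ => 0) (defect := fun _ _ k => defW (k + 1)) (cδ := 1 / 2) (ψ := (LW ^ 2)⁻¹) (m := 1 / 8)
    (s := fun _ _ => 0) (s1 := fun _ _ => 0) (α := fun _ : ℕ => alphaCell (1 / 2))
    (Asz := aszRec (TR K).gen (fun _ _ => 0) (fun _ _ => 0)) (S := fun _ b => {b}) (Sg := fun _ b => {(b, 0)})
    (c := fun _ _ => (0 : ℂ)) (δf := fun _ k _ => dfW k)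
    (fun _ => alphaCell_nonneg (by norm_num)) one_pos (by norm_num) psi_pos.le
    (fun b k' _ _ _ => birthSlice_anti_window (hslR K b k') (Wm.hwcw k'))
    (fun _ k' k _ _ _ _ U => FnR_succ K k' k U) (fun _ _ k _ _ _ _ _ => mem_bddClass_flAt _ _)
    (fun _ _ k _ _ _ _ => realBaseAt_W _ _) (fun _ _ k _ _ _ _ => exponentSliceAt_M _ _ _ _)
    (fun _ _ => by funext U z; simp [zeroExp]) (hSgR K) (fun _ _ => by simp)
    (fun f k'' => aszRec_birth (TR K).gen (fun _ _ => 0) (fun _ _ => 0) f k'')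
    (fun f _ _ _ hk => aszRec_succ (TR K).gen (fun _ _ => 0) (fun _ _ => 0) f hk) (fun _ _ => by simp)
    (fun b k p hp => hδfR K k b p hp) (fun _ k _ _ => hδfwkM k) (fun _ k => hDμM k) (fun _ k => hz₁M k)
    (fun _ _ k _ _ _ _ U₀ _ pd _ _ => (relGauge_pairs k).mono fun z hz t _ => hz (latMove U₀ pd t))
    (fun k hk => hdomR K k hk) (fun _ _ _ _ _ h => h ▸ rfl) (fun _ _ _ k _ => aesm_flAt _ _) (fun _ _ k => hdefwkM k)
    (fun _ k' k _ _ _ => hrateM k' k) (fun b k' k _ _ _ _ ε hε => hlinR K b k' k ε hε)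

/-! ## §2 The bundle over the cell with `c̄ > 0`; END-B's per-cutoff face [folklore] -/

/-- **THE LEAF BUNDLE AT CUTOFF `K` OVER THE CELL WITH LIVE REGENERATION** — row S3's `bookingLeavesCell` over `UR` with regeneration
constants `c := fun _ => c̄_R` (`hcb` an equality), `hreg := hregR K _` (equality at every step), `hbirth := hbirthR K _`, `htr := htrR K`,
no action margins; the cell's (w7) compatibility `ρ + C·c ≤ ρ₁` now has both terms live. [folklore] -/
def leavesR (K : ℕ) : BookingLeaves UR (BR K) (TR K) :=
  bookingLeavesCell one_le_LW (by norm_num) cbarR_pos.le (by norm_num) zero_le_one zero_le_one (by norm_num) locCell_R.le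
    (by norm_num) hsmallR (fun _ => cbarR) (fun _ _ => 0) (fun _ b => {b}) (fun _ => cbarR_pos.le) (fun _ _ => le_rfl)
    (fun k _ _ _ => Nat.zero_le k) (hcountR K) (fun _ _ => by norm_num) (hbirthR K _) (htrR K) (hregR K _)

/-- **END-B's PER-CUTOFF FACE ON THE REGENERATING DATUM**: the class AND every dressed budget gate along the trajectory, at every cutoff
(`classAt_of_bookingLeaves` BY NAME — END-B's closed loop with live transport × live regeneration). [folklore] -/
theorem classAt_towerR (K : ℕ) :
    ClassAt (BR K) UR.A₀ UR.ρ₁ UR.τ ∧ ∀ k, k ≤ (BR K).K → RanBelow (budgetGate (TR K) (leavesR K).s₀ UR.m (leavesR K).S UR.C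
      (leavesR K).ρ) k :=
  classAt_of_bookingLeaves (leavesR K)

/-! ## §3 The root, the With-form, ROOT-B, the consumer face [folklore] -/

/-- **NON-VACUITY OF THE ROOT WITH LIVE REGENERATION, UNIFORMLY IN THE CUTOFF** [decided toy]: `DressedStability towerR` by row S3's
`dressedStability_of_cell` — ONE `UR` (with `c̄ > 0`), ONE schedule, a family regenerating at every step of every cutoff at the maximal
booked rate, every generation carried at function level. [folklore] -/
theorem dressedStability_towerR : DressedStability towerR :=
  dressedStability_of_cell towerR one_le_LW (by norm_num) cbarR_pos.le (by norm_num : (0 : ℝ) ≤ 1 / 2) zero_le_one zero_le_one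
    (by norm_num) locCell_R.le (by norm_num) hsmallR fun _ K => leavesR K

/-- … with the constants displayed: class amplitude `1`, family factor `rhoOne ψ 2 c̄_R ½ = 3∕(4LW)` (its `C·c̄` term live), source decay
`LW⁻³` (`dressedStabilityWith_of_bookingLeaves` BY NAME). [folklore] -/
theorem dressedStabilityWith_towerR :
    DressedStabilityWith towerR 1 (rhoOne (LW ^ 2)⁻¹ (4 * (1 / 2) / 1) cbarR (1 / 2)) (LW⁻¹ ^ 3) :=
  dressedStabilityWith_of_bookingLeaves _ towerR fun _ K => leavesR K

/-- [decided toy] END's consumer face: every booked size of the regenerating toy — the birth generation AND all regenerated generations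
summed (convention (A) with equality) — is below the two-rate profile at EVERY cutoff. [folklore] -/
theorem sizeBound_towerR (p : Unit) (K : ℕ) :
    (towerR.B p K).SizeBound
      (twoRate 1 (rhoOne (LW ^ 2)⁻¹ (4 * (1 / 2) / 1) cbarR (1 / 2)) (LW⁻¹ ^ 3) (towerR.B p K).K) :=
  sizeBound_of_dressedStabilityWith dressedStabilityWith_towerR p K

/-- **ROOT-B ON THE REGENERATING TOY** [decided toy]: for EVERY run-weight family `0 ≤ wt () K j ≤ w̄`, `DressedBudget towerR wt` —
`DressedRootFam`'s `dressedBudget_of_dressedStabilityWith_strict` with the strict product `LW⁴·ρ₁·LW⁻³ = locCell = ¾ < 1` (`prod_cell` ∘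
`locCell_R`) and the one-family positional counts `positionalCount_towerR`. [folklore] -/
theorem dressedBudget_towerR {wbar : ℝ} {wt : Unit → ℕ → ℕ → ℝ} (hwbar : 0 ≤ wbar)
    (hw0 : ∀ p K, ∀ j ≤ K, 0 ≤ wt p K j) (hwb : ∀ p K, ∀ j ≤ K, wt p K j ≤ wbar) : DressedBudget towerR wt :=
  dressedBudget_of_dressedStabilityWith_strict (Λ := LW ^ 4) (N₀ := 1) (r := 3 / 4) dressedStabilityWith_towerR zero_le_one
    (pow_nonneg LW_pos.le 4) (by rw [prod_cell LW_pos]; exact locCell_R.le) (by norm_num) hwbar hw0 hwb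
    fun _ K => positionalCount_towerR K

/-- [decided toy] The closed instance: unit run weights. [folklore] -/
theorem dressedBudget_towerR_one : DressedBudget towerR fun _ _ _ => 1 :=
  dressedBudget_towerR (wbar := 1) zero_le_one (fun _ _ _ _ => zero_le_one) fun _ _ _ _ => le_rfl

/-- **WHAT THE LOOP CONSUMED, READ BACK** [folklore]: at every cutoff and every scale `k < K` the regenerated generation is positive AND
charged at the full cell rate — `0 < gen b (k+1) = c̄ · size b k` with `c̄ = UR`'s regeneration constant — while the class still closes
(`dressedStability_towerR`).  The (w5) shape is live here, not vacuous. -/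
theorem regeneration_at_cell_rate (K k : ℕ) (b : (BR K).Birth) :
    0 < (TR K).gen b (k + 1) ∧ (TR K).gen b (k + 1) = (leavesR K).c k * (BR K).size b k :=
  ⟨regeneration_live K k b, gen_succ_eq K k b⟩

end Summit.QuantumFields.BalabanUV.T4Continuum.NE1p.DressedTowerWitnessRegen

end
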